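import Summits.HodgeConjecture.HodgeConjecture.Theorems.PadicSemiregularLiftHodgeAbelianVarietiesStubSpreadClosing
import Summits.HodgeConjecture.HodgeConjecture.Theorems.HeckePrymWeilHeckePrymAnchorsGlobalClassOfLeray
import Literature.AlgebraicGeometry.HodgeTheory.InvariantClassesFromTotalSpaceHolds
import Literature.AlgebraicGeometry.HodgeTheory.AlgebraicityLocusIUnionClosedProofs
import Literature.AlgebraicGeometry.HodgeTheory.LefschetzOneOneHolds
import Literature.AlgebraicGeometry.HodgeTheory.WeilFamilyReach
import Literature.AlgebraicGeometry.HodgeTheory.GlobalInvariantCycles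
import HarnessLib

/-!
# Crux `HodgeAbelianVarieties` (stmt-HodgeConjecture-1333), line `prym-canonical-z3-split-seeds` — stub `stub_closingFacts`: the partie fixe is no longer owed

The registered stub of the line (skeleton gen 3,
`Cruxes/HodgeAbelianVarieties/Lines/prym_canonical_z3_split_seeds.lean`) is
`stub_closingFacts : ClosingFacts`,
`ClosingFacts := weilFamilyReach_hyperbolic ∧ deligne_globalInvariantCycles` — the two named facts of
the tree from which, together with the three closing facts that are theorems
(`Hironaka1964_smoothCompactification_holds`, `charlesSchnell_algebraicityLocus_iUnion_closed_holds`,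
`lefschetzOneOne_rational_holds`), the landed reduction `spreadClosing_of_weilFamilyReach`
(`Theorems/…StubSpreadClosing`, p116217) proves the closing infrastructure
`SpreadClosing : PrymSpread → Stubs.WeilAlgebraicSplitHyperplane 4 3`.

This helper file (registered sub-goal `spreadClosing_of_weilFamilyReach_hyperbolic`, `--supports` the
crux item) proves that the SECOND conjunct is superfluous:

* `spreadClosing_of_weilFamilyReach_hyperbolic :
    weilFamilyReach_hyperbolic → PrymSpread → Stubs.WeilAlgebraicSplitHyperplane 4 3` —
  `SpreadClosing` from Deligne's polarized Weil family with reach ALONE.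

Why. In p116217 the partie fixe `deligne_globalInvariantCycles` (Hodge II 4.1.1) and Hironaka enter
only through the W-engine `HeckePrymWeilLine.stub_globalClassOfSection` (one global class
`W₀ ∈ H⁸(𝒳(ℂ); ℂ)` of the TOTAL SPACE restricting to the flat Weil section `σ` on every fibre). That
engine needs a class of the open total space `𝒳`, not of a compactification, i.e. only the FIRST of
the three published inputs of the partie fixe — Deligne 1968 / Voisin II Thm. 4.18 (degeneration of
Leray: invariant classes come from the total space), the tree's named fact
`deligne1968_invariantClass_fromTotalSpace` — which is now a THEOREM of the tree
(`deligne1968_invariantClass_fromTotalSpace_holds`, `HodgeTheory/InvariantClassesFromTotalSpaceHolds`: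
Serre fibration by Ehresmann, relative hard Lefschetz from the embedding, Deligne's degeneration
criterion on the Leray–Serre couple, `ℚ → ℂ`). The tree's Leray form of the engine,
`HeckePrymWeilLine.stub_globalClassOfSection_of_leray` (`Theorems/HeckePrymWeilHeckePrymAnchorsGlobalClassOfLeray`),
takes exactly that fact as its hypothesis; fed with the `_holds` theorem it is unconditional. The rest
of the proof is p116217 verbatim (steps (i)–(v): reach family, `W := W₀ + c • H⁴`, fibrewise
rationality and type `(4,4)`, spread on a non-empty open set then everywhere, algebraicity of
`e₁^* σ(s₁)` at the reached fibre, one non-zero algebraic Weil class suffices, isogeny descent), with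
`charlesSchnell_algebraicityLocus_iUnion_closed_holds` and `lefschetzOneOne_rational_holds` supplied.

Consequence for the skeleton (gen 4): `ClosingFacts` may shrink to the ONE named fact
`weilFamilyReach_hyperbolic`, with `stub_spreadClosing := spreadClosing_of_weilFamilyReach_hyperbolic
stub_closingFacts`. What that fact still owes is recorded by the tree's four reduction files
(`WeilFamilyReachOfSystem` → `…OfMonodromy` → `…OfConstruction` → `…OfLevelConstruction`): exactly
Deligne's level-`n` universal abelian scheme with `𝒪_K`-action over `Γ\X⁺` through `(P, ψ₀, h_K)` with
its fibre charts, integral level-`n` monodromy, period-point reach and polarization equation — the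
printed construction ([Deligne1982HodgeCycles, proof of Thm. 4.8]; [MumfordFogartyKirwan1994,
Thm. 7.9–7.10]), for which the tree has no moduli space of abelian varieties (2026-08-16).

No `sorry`, no definition, no named fact taken as hypothesis other than `weilFamilyReach_hyperbolic`.
-/

-- single-problem summit (Problem = Summit): the mandated namespace repeats `HodgeConjecture`.
set_option linter.dupNamespace false

noncomputable section

open CategoryTheory
open Literature.AlgebraicGeometry Literature.AlgebraicGeometry.Motives
  Literature.AlgebraicGeometry.HodgeTheory
open Literature.AlgebraicTopology.SingularHomology

namespace Summit.HodgeConjecture.HodgeConjecture.Cruxes.HodgeAbelianVarieties.PrymCanonicalZ3SplitSeeds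

open AlgebraicGeometry MonoidalCategory CartesianMonoidalCategory Literature.Geometry.Kaehler
open Summit.HodgeConjecture.HodgeConjecture.Cruxes.HodgeAbelianVarieties.EStepSecantInduction

local notation3 (prettyPrint := false) "Res[" f ", " s ", " k ", " A "]" =>
  complexBetti.map (Motives.fiberι f s) k A

/-- **`SpreadClosing` from the Weil-family reach fact ALONE** (registered helper
`spreadClosing_of_weilFamilyReach_hyperbolic` of stmt-HodgeConjecture-1333; the print proof (i)–(v) of
STUB 3 of line `prym-canonical-z3-split-seeds`, with the partie fixe and Hironaka REMOVED). Given the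
`PrymSpread` witness `(P, ψ₀, e, a, w, c)` and a hyperbolic `(A, φ, e_A, a_A)`, `dim A = 8`, `φ² = -3`:
the reach family `f : 𝒳 → S` of `weilFamilyReach_hyperbolic` through `P` with the flat Weil section `σ`
through `w` and the polarization class `H`; `W := W₀ + c • H⁴`, `W₀` the global class of `σ` on the
total space (`stub_globalClassOfSection_of_leray` fed with the THEOREM
`deligne1968_invariantClass_fromTotalSpace_holds` — Leray degeneration, Deligne 1968), restricts at `s₀`
to `e'^{-1*}(w + c h_K⁴)`, is fibrewise rational (`stub_rationalAlongSection`) and of type `(4,4)`; the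
`∀`-clause of `PrymSpread` gives a non-empty open set of algebraicity, the spreading step
(`map_fiberι_mem_algebraicClasses_of_isOpen` with `charlesSchnell_algebraicityLocus_iUnion_closed_holds`)
all of `S(ℂ)`; at the reach point `s₁`, `e₁^*σ(s₁) = e₁^*(W|_{s₁}) - c·(e₁^*H|_{s₁})⁴` is algebraic
(`lefschetzOneOne_rational_holds` for `e₁^*H|_{s₁}`, `spreadClosing_pow4_mem_algebraicClasses`) and is a
non-zero Weil class of `(A', φ')`, so the Weil plane of `A'` is algebraic (one class suffices), and
isogeny descent along `(u, v)` gives `WeilAlgebraicFor 4 3 A φ`. CONDITIONAL on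
`weilFamilyReach_hyperbolic` only. -/
theorem spreadClosing_of_weilFamilyReach_hyperbolic : Literature.AlgebraicGeometry.HodgeTheory.weilFamilyReach_hyperbolic → Summit.HodgeConjecture.HodgeConjecture.Cruxes.HodgeAbelianVarieties.PrymCanonicalZ3SplitSeeds.PrymSpread → Summit.HodgeConjecture.HodgeConjecture.Cruxes.HodgeAbelianVarieties.EStepSecantInduction.Stubs.WeilAlgebraicSplitHyperplane 4 3 := by
  -- adapted from `spreadClosing_of_weilFamilyReach` (Theorems/…StubSpreadClosing, p116217): the
  -- W-engine `stub_globalClassOfSection hD hHir` is replaced by its Leray form fed with the theorem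
  -- `deligne1968_invariantClass_fromTotalSpace_holds`; the two other closing facts are `_holds`.
  have hCS : charlesSchnell_algebraicityLocus_iUnion_closed :=
    charlesSchnell_algebraicityLocus_iUnion_closed_holds
  have hL : lefschetzOneOne_rational := lefschetzOneOne_rational_holds
  rintro hR ⟨P, ψ₀, e, a, w, c, hP, ha, ha0, hhyp, hw, hw0, hrat, hspread⟩ A φ eA aA hA hφ
    haA haA0 hhypA
  -- `(P, ψ₀)`: an abelian eightfold with `ψ₀² = -3`
  have hP8 : P.dim = 2 * 4 := by
    obtain ⟨-, -, -, -, -, -, -, -, -, -, -, h8⟩ := hP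
    exact h8
  have hψ : ψ₀ ≫ ψ₀ = -(3 • 𝟙 P) := comp_self_of_isSchoenPrymPair hP
  have hhyp' : IsHyperbolicWeilType P ψ₀ 4 (((3 : ℕ) : ℂ) • complexBetti.map e.ι 2 a +
      complexBetti.map ψ₀.hom.hom.hom 2 (complexBetti.map e.ι 2 a)) := by
    rw [Nat.cast_ofNat]; exact hhyp
  -- (i)+(ii)+(iv): the reach family through `P`, its flat Weil section through `w`, the polarization
  -- class, and the fibre `A' ≅ 𝒳_{s₁}` `K`-isogenous to `A`
  obtain ⟨𝒳, S, f, s₀, s₁, e', A', φ', e₁, σ, H, hf, hι, hirr, hSm, hSqp, hfib, hH, hHs₀, hσ, hpt, hσH,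
      hσ₀, hA', hφ', ⟨u, v, m, hm, huv, hflat, hv⟩, w₁, hσ₁, hw₁W, hw₁0⟩ :=
    hR 4 3 (by norm_num) (by norm_num) P ψ₀ e a hP8 hψ ha ha0 hhyp' w hw hw0 A φ eA aA hA hφ haA haA0
      hhypA
  rw [Nat.cast_ofNat] at hHs₀
  have h𝒳qp : IsQuasiProjectiveOver 𝒳 := by
    obtain ⟨N, ι, hιc, -⟩ := hι
    haveI := hιc
    exact IsQuasiProjectiveOver.of_isClosedImmersion_projectiveSpace_tensor ι hSqp
  -- the global class `W₀` of the flat Weil section (partie fixe + Hironaka, W-engine PROVED)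
  obtain ⟨W₀, hW₀⟩ :=
    Summit.HodgeConjecture.HodgeConjecture.Theorems.HeckePrymWeilLine.stub_globalClassOfSection_of_leray
      deligne1968_invariantClass_fromTotalSpace_holds
      f (2 * 4) (2 * 4) hf hι hSm hSqp hirr σ hσ hpt
  have hcls : ∀ (s : ComplexPoints S) (y : complexBetti (fiberOver f s) (2 * 4)),
      σ s = ⟨s, y⟩ → Res[f, s, 2 * 4, W₀] = y := fun s y hy =>
    (FiberClass.mk_eq_mk_iff _ _).1 ((hW₀ s).symm.trans hy)
  -- the global class `W := W₀ + c • H⁴` and its fibre restrictions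
  set W : complexBetti 𝒳 (2 * 4) := W₀ + c • pow4 H with hWdef
  have hWres : ∀ t, Res[f, t, 2 * 4, W] = Res[f, t, 2 * 4, W₀] + c • pow4 (Res[f, t, 2, H]) := by
    intro t
    rw [hWdef, map_add, map_smul, spreadClosing_pow4_map]
  -- anchor: `e'^*(W|_{s₀}) = w + c • h_K⁴`
  have hWs₀ : complexBetti.map e'.hom (2 * 4) (Res[f, s₀, 2 * 4, W]) = w + c • pow4 (symHyp ψ₀ e a) := by
    rw [hWres, map_add, map_smul, spreadClosing_pow4_map, hcls s₀ _ hσ₀, hHs₀]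
    congr 1
    exact map_hom_map_inv_apply e' (2 * 4) w
  -- fibrewise rationality of `W` (flat transport of the rational class `w + c • h_K⁴`)
  have hrat₀ : IsRationalClass (Res[f, s₀, 2 * 4, W]) := by
    have key : Res[f, s₀, 2 * 4, W] =
        complexBetti.map e'.inv (2 * 4) (complexBetti.map e'.hom (2 * 4) (Res[f, s₀, 2 * 4, W])) :=
      (map_hom_map_inv_apply e'.symm (2 * 4) _).symm
    rw [key, hWs₀]
    exact hrat.pullback _
  have hWrat : ∀ s, IsRationalClass (Res[f, s, 2 * 4, W]) := fun s =>
    Summit.HodgeConjecture.HodgeConjecture.Theorems.HeckePrymWeilLine.stub_rationalAlongSection f (2 * 4)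
      (2 * 4) hf hSm hSqp hirr (globalSection f (2 * 4) W) (continuous_globalSection f _ W)
      (fun _ => rfl) s₀ hrat₀ s
  -- fibrewise Hodge type `(4,4)` of `W`
  have hWH : ∀ s, IsOfHodgeType (2 * 4) (fiberOver f s) (2 * 4) 4 4 (Res[f, s, 2 * 4, W]) := by
    intro s
    have hX := hf.isSmoothProjective s
    have h1 : IsOfHodgeType (2 * 4) (fiberOver f s) (2 * 4) 4 4 (Res[f, s, 2 * 4, W₀]) := by
      have h := hσH s
      rw [hW₀ s] at h
      exact h
    rw [hWres]
    exact h1.add hX ((spreadClosing_pow4_isOfHodgeType hX (hH s).2).smul c)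
  -- (iii) SPREAD: the `∀`-clause of `PrymSpread` along the reach family, then Baire + irreducibility
  obtain ⟨U, hU, hUne, hUalg⟩ := hspread 𝒳 S f s₀ e' W H hf h𝒳qp hSqp hSm hirr hfib
    (fun s => ⟨hWrat s, hWH s⟩) hH hWs₀ hHs₀
  have hall : ∀ t, Res[f, t, 2 * 4, W] ∈ algebraicClasses (fiberOver f t) 4 :=
    SubtorusGalleryBlochSeeds.Stubs.map_fiberι_mem_algebraicClasses_of_isOpen hCS f h𝒳qp hSqp hSm
      hirr hf W hU hUne hUalg
  -- (iv) at the reach point: `e₁^*σ(s₁)` is a non-zero ALGEBRAIC Weil class of `(A', φ')`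
  have hX₁ := hf.isSmoothProjective s₁
  have hA'sp : IsSmoothProjective (2 * 4) A'.X := isSmoothProjective_of_dim_eq' hA'
  have halg₁ : complexBetti.map e₁.hom (2 * 4) (Res[f, s₁, 2 * 4, W]) ∈ algebraicClasses A'.X 4 :=
    mem_algebraicClasses_map_of_iso hX₁ hA'sp e₁ (hall s₁)
  have hH₁ : complexBetti.map e₁.hom 2 (Res[f, s₁, 2, H]) ∈ algebraicClasses A'.X 1 :=
    hL hA'sp _ ((hH s₁).1.pullback _) ((hH s₁).2.map_of_iso e₁)
  have hw₁eq : complexBetti.map e₁.hom (2 * 4) w₁ =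
      complexBetti.map e₁.hom (2 * 4) (Res[f, s₁, 2 * 4, W]) -
        c • pow4 (complexBetti.map e₁.hom 2 (Res[f, s₁, 2, H])) := by
    rw [hWres, map_add, map_smul, spreadClosing_pow4_map, hcls s₁ w₁ hσ₁, add_sub_cancel_right]
  have hw₁alg : complexBetti.map e₁.hom (2 * 4) w₁ ∈ algebraicClasses A'.X 4 := by
    rw [hw₁eq]
    exact Submodule.sub_mem _ halg₁ (Submodule.smul_mem _ c (spreadClosing_pow4_mem_algebraicClasses A' hH₁))
  -- one class suffices: the whole Weil plane of `(A', φ')` is algebraic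
  have hplane : weilClassesOf A' φ' 4 3 ≤ algebraicClasses A'.X 4 :=
    (weilClassesOf_le_algebraicClasses_iff_exists_ne_zero_of_dim_eq
      abelianVarietyCohomologyExteriorH1_holds hA' (by norm_num) (by norm_num) hφ').2
      ⟨_, hw₁W, hw₁alg, hw₁0⟩
  -- (v) ISOGENY DESCENT to `(A, φ)`
  have hAsp : IsSmoothProjective (2 * 4) A.X := isSmoothProjective_of_dim_eq' hA
  obtain ⟨MB⟩ := nonempty_hodgeModel_holds (n := 2 * 4) (X := A'.X) hA'sp
  haveI : Flat u.hom.hom.hom.left := hflat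
  intro x hxW hxr hxH
  exact mem_algebraicClasses_of_isogeny_of_mem_weilClassesOf hAsp hA'sp MB u v hv hm huv
    (fun y _ _ hy => hplane hy) hxr hxH hxW

end Summit.HodgeConjecture.HodgeConjecture.Cruxes.HodgeAbelianVarieties.PrymCanonicalZ3SplitSeeds

end
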